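import Summits.QuantumFields.QCD.Theses.WilsonQuarkChessboard
import Summits.QuantumFields.QCD.Theses.QuarksAsStableAction
import Summits.QuantumFields.QCD.Theorems.WilsonQuarkChessboardQuarkChessboard

/-!
# Crux `WilsonQuarkChessboard.MassiveBridge` (stmt-QuantumFields-17577) IS the shared item
# `ThresholdQCD` (stmt-QuantumFields-8794) behind the route's two chessboard hypotheses — kernel-checked by `Iff.rfl`

Line `registered` (skeleton `Cruxes/MassiveBridge/Lines/birth.lean`), continuation lead
`prover-line-stmt-QuantumFields-17577-c1-0`, 2026-08-17.

The crux reads `QuarkChessboard → FlatCellOptimal → Θ`, where the consequent `Θ` — "for `N_f ∈ {2,3}` there are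
`M₀ ≥ 0` and a mass-independent regularisation with `HasMassScaling` such that every mass tuple above `M₀` carries
OS data with `IsQCDAlong`, non-trivial non-Gaussian glue, non-decoupled flavour-changing pseudoscalars and one rate
`Δ > 0` for `T.HasMassGap` and `HasLatticeMassGap`" — is, CHARACTER FOR CHARACTER, the statement of the shared
item stmt-QuantumFields-8794 `ThresholdQCD` (crux rank 7 of route `QuarksAsStableAction`, and under the same item id
the TARGET of route `HeavyThresholdYMBridge`): the threshold form of `QCDOf 2 ∧ QCDOf 3` without the chiral clause.
Lean agrees definitionally (`massiveBridge_iff_imp_thresholdQCD` is `Iff.rfl`).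

Consequences recorded here (pure logic; the quark chessboard C is PROVED in the tree,
`wilsonQuarkChessboardQuarkChessboard_proof`, item stmt-QuantumFields-9306 @ b37869be232f):

* `massiveBridge_iff_flatCellOptimal_imp_thresholdQCD` — `MassiveBridge ↔ (FlatCellOptimal → ThresholdQCD)`;
* `massiveBridge_of_thresholdQCD` — item 8794 closes this crux by one application (both hypotheses idle);
* `thresholdQCD_of_massiveBridge` — conversely this crux together with the route's crux K (`FlatCellOptimal`,
  stmt-QuantumFields-9307) closes item 8794, hence the target of `HeavyThresholdYMBridge`;
* `massiveBridge_iff_thresholdQCD_of_flatCellOptimal` — given K, the two items are equivalent.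

So the crux is not a new debt: modulo the idle, numerically robust hypothesis K it is EXACTLY item 8794
(constructive massive QCD with a full-spectrum gap above an unpinned flavour-blind offset — open problem,
Jaffe–Witten 2000 §5).  The finer three-law cut of the skeleton (UV item 8695, lattice law 8922, species
clustering law) refines the same debt (`massiveBridge_of_items`, `massiveBridge_of_sharedLaws`, landed p149234).

References: Jaffe–Witten 2000 §1, §5 (existence and mass gap of four-dimensional gauge theories with quarks);
Montvay–Münster 1994 §5.1 (Wilson quark masses, flavour-blind critical mass — the offset `M₀`).
-/

namespace Summit.QuantumFields.QCD.Theorems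

open Summit.QuantumFields.QCD.Theses
open Summit.QuantumFields.QCD.Theses.WilsonQuarkChessboard

/-- **The crux is `C → K → ThresholdQCD`, definitionally.**  The consequent of
`WilsonQuarkChessboard.MassiveBridge` is verbatim the shared item `QuarksAsStableAction.ThresholdQCD`
(stmt-QuantumFields-8794): the two sides are syntactically equal after unfolding the two route `def`s, so the
equivalence is `Iff.rfl`. [cite: JaffeWitten2000, §5] -/
theorem massiveBridge_iff_imp_thresholdQCD :
    MassiveBridge ↔ (QuarkChessboard → FlatCellOptimal → QuarksAsStableAction.ThresholdQCD) :=
  Iff.rfl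

/-- **`MassiveBridge ↔ (FlatCellOptimal → ThresholdQCD)`**: the quark chessboard C is proved
(`wilsonQuarkChessboardQuarkChessboard_proof`), so only the flat-cell optimum K (stmt-QuantumFields-9307) remains
in front of item stmt-QuantumFields-8794. [cite: JaffeWitten2000, §5] -/
theorem massiveBridge_iff_flatCellOptimal_imp_thresholdQCD :
    MassiveBridge ↔ (FlatCellOptimal → QuarksAsStableAction.ThresholdQCD) :=
  ⟨fun h hK => h wilsonQuarkChessboardQuarkChessboard_proof hK, fun h _ hK => h hK⟩

/-- **Item stmt-QuantumFields-8794 ⇒ this crux** (modus-ponens form for the day the shared item lands: both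
chessboard hypotheses are idle).  CONDITIONAL on `ThresholdQCD` (open problem: constructive massive QCD with a
full-spectrum mass gap). [cite: JaffeWitten2000, §5] -/
theorem massiveBridge_of_thresholdQCD (h : QuarksAsStableAction.ThresholdQCD) : MassiveBridge :=
  fun _ _ => h

/-- **This crux ∧ K ⇒ item stmt-QuantumFields-8794** (the cross-route edge: if route `WilsonQuarkChessboard`
lands `FlatCellOptimal` and `MassiveBridge`, the shared threshold item — crux rank 7 of `QuarksAsStableAction`,
target of `HeavyThresholdYMBridge` — closes by this line).  CONDITIONAL on the two route items.
[cite: JaffeWitten2000, §5] -/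
theorem thresholdQCD_of_massiveBridge (hM : MassiveBridge) (hK : FlatCellOptimal) :
    QuarksAsStableAction.ThresholdQCD :=
  hM wilsonQuarkChessboardQuarkChessboard_proof hK

/-- **Given K, the crux and item 8794 are equivalent.** [cite: JaffeWitten2000, §5] -/
theorem massiveBridge_iff_thresholdQCD_of_flatCellOptimal (hK : FlatCellOptimal) :
    MassiveBridge ↔ QuarksAsStableAction.ThresholdQCD :=
  ⟨fun hM => thresholdQCD_of_massiveBridge hM hK, massiveBridge_of_thresholdQCD⟩

end Summit.QuantumFields.QCD.Theorems
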